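import Summits.BirchSwinnertonDyer.BirchSwinnertonDyer.Theorems.ByReductionTypeAtTwoRankOneAtTwoOffBigImageOddLocalEngineLocalTriviality
import HarnessLib

/-!
# Route `ByReductionTypeAtTwo`, crux `RankOneAtTwoOffBigImageOddLocal` (stmt-BirchSwinnertonDyer-23716), line
# `refined_kolyvagin_tamagawa_shift_at_two` — ENGINE PORT `c₀ ↦ h₀` (regular element): §K′/§M′ the UNIFORM supply (ONE regular `h = c₀ · res ρ` for ALL bounds) and the self-contained primes-only supply

Lead prover `prover-cruxlead-stmt-BirchSwinnertonDyer-23716-g2` (2026-08-28, KEEP-by-lineage successor of `…-g0`), landing the part of the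
crux-plan g6 ENGINE QUARRY `Cruxes/RankOneAtTwoOffBigImageOddLocal/RefinedKolyvaginEngineG6.lean` published as v12 (commit 2a88e2efeb5d, planner
`cruxplan-…-23716-refined-kolyvag-9ff2fe475f-g6`, rc 0 / 0 sorry) AFTER the g0 lead had landed §K/§M from v10/v11
(`…EngineEndToEnd.lean` p652247, `…EngineStubVocabulary.lean` p652837).  The landed §K/§M theorems take the bound `(b : ℕ)` BEFORE producing
`ρ` (`∀ b, ∃ ρ, … ∧ ∃ ℓ > b, …`), so the regular element may change with the bound; v12 produces ONE `ρ` — one lossless `μ`-inverting regular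
involution `h = c₀ · res ρ` on `E[2^{n+1}]` — and THEN, for every bound, a Kolyvagin prime whose Frobenius is that same `h` (`∃ ρ, … ∧ ∀ b, ∃ ℓ > b, …`).
This is the quantifier order an Euler-system consumer needs (all Kolyvagin primes of one argument drawn from the Čebotarev class of one `h`), and
it costs nothing: §F's `exists_kolyvaginPrime_gt_two_of_galoisElement_regular` is already uniform in `b` once `ρ` is fixed.  Landed files are
append-only and their statements are not edited, so the uniform forms are NEW declarations (suffix `_uniform`); proofs are the quarry's verbatim.

THIS FILE.
* §K′ `exists_regular_kolyvaginPrime_of_supply_uniform` / `_of_doorAdmissible_uniform` / `_of_heegner_uniform` — §K with `∃ ρ` outside `∀ b`.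
* §M′ `exists_regular_zhangKolyvaginPrimes_of_heegner_uniform` — the same in the big-image stubs' vocabulary (`Zhang2014.IsKolyvaginPrime N W K 2 ℓ`,
  `M(ℓ) ≥ n + 1`); and the SELF-CONTAINED primes-only supply
  `exists_regular_zhangKolyvaginPrimes_of_heegner_primesOnly` (no classes, `r = 0`; the complex conjugations `c₀ ∈ Γ_ℚ`, `c ∈ Aut(K/ℚ)` are
  PRODUCED): hypotheses = Čebotarev + the stub binders `IsImaginaryQuadratic K`, `Odd d_K`, `SatisfiesHeegnerHypothesis N_E K`, `ρ̄_{E,2}` onto,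
  `ρ̄_{E,2^{n+1}}` onto — S3′'s `n`-supply at any level.

Nothing here proves the crux, `BSDp W 2`, BSD or the summit; no registered stub is discharged (engine inputs only, conditional on the displayed tree
token `Automorphic.chebotarev_artinRep` exactly like §K).  BSD is not proved.

Refs: [GrossLMS1991] §3 (3.1)–(3.3), §9 Prop. 9.3; [McCallumLMS1991] §3 Cor. 3.2; [WZhang2014] Notations (xii).
-/

set_option linter.dupNamespace false -- tree convention: `Summit.BirchSwinnertonDyer.BirchSwinnertonDyer.Theorems` (summit = sub-problem)
set_option autoImplicit false

noncomputable section

namespace Summit.BirchSwinnertonDyer.BirchSwinnertonDyer.Theorems.OffBigImageOddLocalAtTwo.Engine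

/-! ## §K′  THE ENGINE PORT END-TO-END, UNIFORM IN THE BOUND: one regular `h = c₀ · res ρ`, Kolyvagin primes beyond every bound -/

section EnginePortKUniform

open scoped Classical Pointwise
open WeierstrassCurve NumberField IsDedekindDomain Field
open Literature.NumberTheory.GaloisRepresentations Literature.NumberTheory.EllipticCurves
open Literature.NumberTheory
open Rat.HeightOneSpectrum
open Summit.BirchSwinnertonDyer.BirchSwinnertonDyer.Theorems

universe u

variable {W : WeierstrassCurve ℚ} {K : Type u} [Field K] [NumberField K]

/-- **THE REGULAR KOLYVAGIN PRIME FROM THE SKELETON'S BINDERS (E-port = §J → §H → §F, PROVED).**  `E/ℚ` globally minimal, `K` imaginary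
quadratic with `d_K` door-admissible, `ρ̄_{E,2^{M}}` surjective (`M = n+1 ≥ 1`), `c₀` complex conjugation, `c ≠ 1` in `Gal(K/ℚ)`, the tree's image
tokens `hS`/`hC` on `E(K̄)[2]`, and τ-stable Selmer-class data `cs, π, e, Nv` exactly as in the tree's Step B: then there are `ρ ∈ Γ_K` with
`h := c₀ · res ρ` an INVOLUTION on `E(ℚ̄)[2^M]` acting there as the REGULAR involution `[[1,1],[0,-1]]` (so `Frob_ℓ ∼ h` has `tr ≡ 0`,
`det ≡ -1`, and `Ẽ(𝔽_ℓ)[2^∞]` CYCLIC — not `∼ c₀`), and for every bound `b` a Kolyvagin prime `ℓ > b`: `ℓ ∤ 2 N d_K`, `(ℓ)` inert in `K`,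
a Frobenius above `ℓ` acting on `E[2^M]` as `h` and on `K` as `c₀`, `2^M ∣ ℓ + 1`, `2^M ∣ a_ℓ`, and `ord c_{i,λ} = 2^{Nv i}` exactly at `λ ∋ ℓ`.
Conditional only on the displayed tree theorem-token `hC : Automorphic.chebotarev_artinRep`.  This is the pen's kernel-closable #3 up to
the renaming of the `FrobEqFrobInfty` token in the Euler-system files (E4). [cite: GrossLMS1991, §3 (3.1)–(3.3), §9 Prop. 9.3]
[cite: McCallumLMS1991, §3 Cor. 3.2] -/
theorem exists_regular_kolyvaginPrime_of_supply_uniform (hCheb : Automorphic.chebotarev_artinRep) {N : ℕ}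
    [NeZero N] [W.IsElliptic] [W.IsGloballyMinimal] (hK : IsImaginaryQuadratic K) (n : ℕ)
    {c₀ : absoluteGaloisGroup ℚ} (hc₀ : IsComplexConjugation (Rat.castHom ℝ) c₀)
    (hsup : ∀ A : AddAut (geomTorsion W ((2 ^ (n + 1) : ℕ) : ℤ)),
      ∃ ρ₀ : absoluteGaloisGroup K, ∀ P : geomTorsion W ((2 ^ (n + 1) : ℕ) : ℤ),
        (c₀ * absGaloisRestrict ℚ K ρ₀) • P = A P)
    {c : K ≃ₐ[ℚ] K} (hc : c ≠ 1)
    (hS : ∀ H : AddSubgroup (geomTorsion (W.baseChange K) 2),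
      (∀ g : absoluteGaloisGroup K, ∀ t ∈ H, g • t ∈ H) → H = ⊥ ∨ H = ⊤)
    (hC : ∀ f : geomTorsion (W.baseChange K) 2 →+ geomTorsion (W.baseChange K) 2,
      (∀ (g : absoluteGaloisGroup K) (t : geomTorsion (W.baseChange K) 2), f (g • t) = g • f t) →
        ∃ c : ℤ, ∀ t, f t = c • t)
    {r : ℕ} (cs : Fin r → galH1Torsion (W.baseChange K) ((2 ^ (n + 1) : ℕ) : ℤ)) {π : Fin r → Fin r}
    (hπ : ∀ i, π (π i) = i) (hcs : ∀ i, conjAct W c ((2 ^ (n + 1) : ℕ) : ℤ) (cs i) = cs (π i))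
    (e : Fin r → ℕ) (he : ∀ i, ((2 : ℤ) ^ e i) • cs i = 0)
    (hind : ∀ a : Fin r → ℤ, ∑ i, a i • cs i = 0 → ∀ i, ((2 : ℤ) ^ e i) ∣ a i)
    (hres : ∀ a : Fin r → ℤ, (∀ ρ ∈ torsionFixing (W.baseChange K) ((2 ^ (n + 1) : ℕ) : ℤ),
      h1Eval (W.baseChange K) ((2 ^ (n + 1) : ℕ) : ℤ) (∑ i, a i • cs i) ρ = 0) → ∑ i, a i • cs i = 0)
    (Nv : Fin r → ℕ) (hNe : ∀ i, Nv i ≤ e i) (heM : ∀ i, e i ≤ n + 1) (hNπ : ∀ i, Nv (π i) = Nv i) :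
    ∃ ρ : absoluteGaloisGroup K,
      (∀ X : geomTorsion W ((2 ^ (n + 1) : ℕ) : ℤ),
        (c₀ * absGaloisRestrict ℚ K ρ) • (c₀ * absGaloisRestrict ℚ K ρ) • X = X) ∧
      (∀ ζ : AlgebraicClosure ℚ, ζ ^ (2 ^ (n + 1)) = 1 → (c₀ * absGaloisRestrict ℚ K ρ) • ζ = ζ⁻¹) ∧
      (∃ P : geomTorsion W ((2 ^ (n + 1) : ℕ) : ℤ),
        (2 : ℤ) ^ n • (P + (c₀ * absGaloisRestrict ℚ K ρ) • P) ≠ 0) ∧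
      (∀ (k : ℕ) (X : geomTorsion W ((2 ^ (n + 1) : ℕ) : ℤ)), (2 : ℤ) ^ k • X = 0 →
          (c₀ * absGaloisRestrict ℚ K ρ) • X = X →
          ∃ Y : geomTorsion W ((2 ^ (n + 1) : ℕ) : ℤ),
            (2 : ℤ) ^ k • Y = 0 ∧ X = Y + (c₀ * absGaloisRestrict ℚ K ρ) • Y) ∧
      ∀ b : ℕ, ∃ ℓ : ℕ, b < ℓ ∧ ℓ.Prime ∧ ¬ ℓ ∣ N ∧ ¬ ((ℓ : ℤ) ∣ NumberField.discr K) ∧ ℓ ≠ 2 ∧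
        (Ideal.span {(ℓ : 𝓞 K)}).IsPrime ∧
        (∃ (v : HeightOneSpectrum (𝓞 ℚ)) (𝔓 : Ideal (absIntegers (𝓞 ℚ) ℚ)) (h : absoluteGaloisGroup ℚ),
          (ℓ : 𝓞 ℚ) ∈ v.asIdeal ∧ 𝔓 ∈ v.primesAbove ∧ IsArithFrobAt (𝓞 ℚ) h 𝔓 ∧
          (∀ P : geomTorsion W ((2 ^ (n + 1) : ℕ) : ℤ), h • P = (c₀ * absGaloisRestrict ℚ K ρ) • P) ∧
          ∀ (e : K →ₐ[ℚ] AlgebraicClosure ℚ) (x : K), h • e x = c₀ • e x) ∧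
        2 ^ (n + 1) ∣ ℓ + 1 ∧ ((2 : ℤ) ^ (n + 1)) ∣ W.frobeniusTrace ℓ ∧
        ∀ i, ∀ v : HeightOneSpectrum (𝓞 K), (ℓ : 𝓞 K) ∈ v.asIdeal →
          (((2 : ℤ) ^ Nv i) • cs i ∈
              (W.baseChange K).torsionLocalKer (v.adicCompletion K) ((2 ^ (n + 1) : ℕ) : ℤ) ∧
            (Nv i ≠ 0 → ((2 : ℤ) ^ (Nv i - 1)) • cs i ∉
              (W.baseChange K).torsionLocalKer (v.adicCompletion K) ((2 ^ (n + 1) : ℕ) : ℤ))) := by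
  obtain ⟨ρ₀, P, hsq, hP1, hker, hμ'⟩ := exists_regular_galoisElement_of_supply (K := K) n c₀ hsup
  have hM : 1 ≤ n + 1 := by omega
  obtain ⟨ρ, hact, hsqρ, hρ⟩ := exists_galoisElement_regular_rat (W := W) hK hM hc₀ hc hS hC ρ₀ hsq
    (P := P) (fun _ ↦ by simpa using hP1) (fun k X _ h1 h2 ↦ hker k X h1 h2) hπ hcs e he hind hres
    Nv hNe heM hNπ
  have hμ : ∀ ζ : AlgebraicClosure ℚ, ζ ^ (2 ^ (n + 1)) = 1 →
      (c₀ * absGaloisRestrict ℚ K ρ) • ζ = ζ⁻¹ := hμ' _ hact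
  refine ⟨ρ, hsqρ, hμ, ⟨P, ?_⟩, fun k X h1 h2 ↦ ?_, fun b ↦
    exists_kolyvaginPrime_gt_two_of_galoisElement_regular hCheb hK hM hc₀ hc cs Nv hsqρ hμ hρ b⟩
  · rw [hact]; exact hP1
  · rw [hact] at h2
    obtain ⟨Y, hY, hXY⟩ := hker k X h1 h2
    exact ⟨Y, hY, by rw [hact]; exact hXY⟩


/-- **THE REGULAR KOLYVAGIN PRIME FOR THE DOOR-LAW STUBS** (binder `DoorAdmissible W d_K`). [cite: GrossLMS1991, §3, §9] -/
theorem exists_regular_kolyvaginPrime_of_doorAdmissible_uniform (hCheb : Automorphic.chebotarev_artinRep) {N : ℕ}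
    [NeZero N] [W.IsElliptic] [W.IsGloballyMinimal] (hK : IsImaginaryQuadratic K)
    (hD : RankOneAtTwoOneDoor.DoorAdmissible W (NumberField.discr K)) (n : ℕ)
    (hρ2 : W.HasSurjectiveModNGaloisRep 2) (hsurj : W.HasSurjectiveModNGaloisRep ((2 ^ (n + 1) : ℕ) : ℤ))
    {c₀ : absoluteGaloisGroup ℚ} (hc₀ : IsComplexConjugation (Rat.castHom ℝ) c₀)
    {c : K ≃ₐ[ℚ] K} (hc : c ≠ 1)
    {r : ℕ} (cs : Fin r → galH1Torsion (W.baseChange K) ((2 ^ (n + 1) : ℕ) : ℤ)) {π : Fin r → Fin r}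
    (hπ : ∀ i, π (π i) = i) (hcs : ∀ i, conjAct W c ((2 ^ (n + 1) : ℕ) : ℤ) (cs i) = cs (π i))
    (e : Fin r → ℕ) (he : ∀ i, ((2 : ℤ) ^ e i) • cs i = 0)
    (hind : ∀ a : Fin r → ℤ, ∑ i, a i • cs i = 0 → ∀ i, ((2 : ℤ) ^ e i) ∣ a i)
    (hres : ∀ a : Fin r → ℤ, (∀ ρ ∈ torsionFixing (W.baseChange K) ((2 ^ (n + 1) : ℕ) : ℤ),
      h1Eval (W.baseChange K) ((2 ^ (n + 1) : ℕ) : ℤ) (∑ i, a i • cs i) ρ = 0) → ∑ i, a i • cs i = 0)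
    (Nv : Fin r → ℕ) (hNe : ∀ i, Nv i ≤ e i) (heM : ∀ i, e i ≤ n + 1) (hNπ : ∀ i, Nv (π i) = Nv i) :
    ∃ ρ : absoluteGaloisGroup K,
      (∀ X : geomTorsion W ((2 ^ (n + 1) : ℕ) : ℤ),
        (c₀ * absGaloisRestrict ℚ K ρ) • (c₀ * absGaloisRestrict ℚ K ρ) • X = X) ∧
      (∀ ζ : AlgebraicClosure ℚ, ζ ^ (2 ^ (n + 1)) = 1 → (c₀ * absGaloisRestrict ℚ K ρ) • ζ = ζ⁻¹) ∧
      (∃ P : geomTorsion W ((2 ^ (n + 1) : ℕ) : ℤ),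
        (2 : ℤ) ^ n • (P + (c₀ * absGaloisRestrict ℚ K ρ) • P) ≠ 0) ∧
      (∀ (k : ℕ) (X : geomTorsion W ((2 ^ (n + 1) : ℕ) : ℤ)), (2 : ℤ) ^ k • X = 0 →
          (c₀ * absGaloisRestrict ℚ K ρ) • X = X →
          ∃ Y : geomTorsion W ((2 ^ (n + 1) : ℕ) : ℤ),
            (2 : ℤ) ^ k • Y = 0 ∧ X = Y + (c₀ * absGaloisRestrict ℚ K ρ) • Y) ∧
      ∀ b : ℕ, ∃ ℓ : ℕ, b < ℓ ∧ ℓ.Prime ∧ ¬ ℓ ∣ N ∧ ¬ ((ℓ : ℤ) ∣ NumberField.discr K) ∧ ℓ ≠ 2 ∧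
        (Ideal.span {(ℓ : 𝓞 K)}).IsPrime ∧
        (∃ (v : HeightOneSpectrum (𝓞 ℚ)) (𝔓 : Ideal (absIntegers (𝓞 ℚ) ℚ)) (h : absoluteGaloisGroup ℚ),
          (ℓ : 𝓞 ℚ) ∈ v.asIdeal ∧ 𝔓 ∈ v.primesAbove ∧ IsArithFrobAt (𝓞 ℚ) h 𝔓 ∧
          (∀ P : geomTorsion W ((2 ^ (n + 1) : ℕ) : ℤ), h • P = (c₀ * absGaloisRestrict ℚ K ρ) • P) ∧
          ∀ (e : K →ₐ[ℚ] AlgebraicClosure ℚ) (x : K), h • e x = c₀ • e x) ∧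
        2 ^ (n + 1) ∣ ℓ + 1 ∧ ((2 : ℤ) ^ (n + 1)) ∣ W.frobeniusTrace ℓ ∧
        ∀ i, ∀ v : HeightOneSpectrum (𝓞 K), (ℓ : 𝓞 K) ∈ v.asIdeal →
          (((2 : ℤ) ^ Nv i) • cs i ∈
              (W.baseChange K).torsionLocalKer (v.adicCompletion K) ((2 ^ (n + 1) : ℕ) : ℤ) ∧
            (Nv i ≠ 0 → ((2 : ℤ) ^ (Nv i - 1)) • cs i ∉
              (W.baseChange K).torsionLocalKer (v.adicCompletion K) ((2 ^ (n + 1) : ℕ) : ℤ))) := by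
  obtain ⟨hS, hC⟩ := imageTokens_two_of_doorAdmissible (W := W) hK hD hρ2
  exact exists_regular_kolyvaginPrime_of_supply_uniform hCheb hK n hc₀ (fun A ↦
    exists_mul_absGaloisRestrict_smul_eq_addAut_of_doorAdmissible hK hD hsurj c₀ A) hc hS hC cs hπ hcs e he hind hres Nv hNe heM hNπ

/-- **THE REGULAR KOLYVAGIN PRIME FOR THE BIG-IMAGE STUBS S3/S4/S5** (binders `Odd d_K`, `SatisfiesHeegnerHypothesis N_E K` — verbatim those of
`SigmaAccumulationAtTwo` / `StringentPrimitivityAtTwo` / `ShiftedKolyvaginStructureAtTwo`). [cite: GrossLMS1991, §3, §9] -/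
theorem exists_regular_kolyvaginPrime_of_heegner_uniform (hCheb : Automorphic.chebotarev_artinRep) {N : ℕ}
    [NeZero N] [W.IsElliptic] [W.IsGloballyMinimal] (hK : IsImaginaryQuadratic K)
    (hodd : Odd (NumberField.discr K)) (hH : SatisfiesHeegnerHypothesis (W.conductorNorm ℤ) K) (n : ℕ)
    (hρ2 : W.HasSurjectiveModNGaloisRep 2) (hsurj : W.HasSurjectiveModNGaloisRep ((2 ^ (n + 1) : ℕ) : ℤ))
    {c₀ : absoluteGaloisGroup ℚ} (hc₀ : IsComplexConjugation (Rat.castHom ℝ) c₀)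
    {c : K ≃ₐ[ℚ] K} (hc : c ≠ 1)
    {r : ℕ} (cs : Fin r → galH1Torsion (W.baseChange K) ((2 ^ (n + 1) : ℕ) : ℤ)) {π : Fin r → Fin r}
    (hπ : ∀ i, π (π i) = i) (hcs : ∀ i, conjAct W c ((2 ^ (n + 1) : ℕ) : ℤ) (cs i) = cs (π i))
    (e : Fin r → ℕ) (he : ∀ i, ((2 : ℤ) ^ e i) • cs i = 0)
    (hind : ∀ a : Fin r → ℤ, ∑ i, a i • cs i = 0 → ∀ i, ((2 : ℤ) ^ e i) ∣ a i)
    (hres : ∀ a : Fin r → ℤ, (∀ ρ ∈ torsionFixing (W.baseChange K) ((2 ^ (n + 1) : ℕ) : ℤ),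
      h1Eval (W.baseChange K) ((2 ^ (n + 1) : ℕ) : ℤ) (∑ i, a i • cs i) ρ = 0) → ∑ i, a i • cs i = 0)
    (Nv : Fin r → ℕ) (hNe : ∀ i, Nv i ≤ e i) (heM : ∀ i, e i ≤ n + 1) (hNπ : ∀ i, Nv (π i) = Nv i) :
    ∃ ρ : absoluteGaloisGroup K,
      (∀ X : geomTorsion W ((2 ^ (n + 1) : ℕ) : ℤ),
        (c₀ * absGaloisRestrict ℚ K ρ) • (c₀ * absGaloisRestrict ℚ K ρ) • X = X) ∧
      (∀ ζ : AlgebraicClosure ℚ, ζ ^ (2 ^ (n + 1)) = 1 → (c₀ * absGaloisRestrict ℚ K ρ) • ζ = ζ⁻¹) ∧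
      (∃ P : geomTorsion W ((2 ^ (n + 1) : ℕ) : ℤ),
        (2 : ℤ) ^ n • (P + (c₀ * absGaloisRestrict ℚ K ρ) • P) ≠ 0) ∧
      (∀ (k : ℕ) (X : geomTorsion W ((2 ^ (n + 1) : ℕ) : ℤ)), (2 : ℤ) ^ k • X = 0 →
          (c₀ * absGaloisRestrict ℚ K ρ) • X = X →
          ∃ Y : geomTorsion W ((2 ^ (n + 1) : ℕ) : ℤ),
            (2 : ℤ) ^ k • Y = 0 ∧ X = Y + (c₀ * absGaloisRestrict ℚ K ρ) • Y) ∧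
      ∀ b : ℕ, ∃ ℓ : ℕ, b < ℓ ∧ ℓ.Prime ∧ ¬ ℓ ∣ N ∧ ¬ ((ℓ : ℤ) ∣ NumberField.discr K) ∧ ℓ ≠ 2 ∧
        (Ideal.span {(ℓ : 𝓞 K)}).IsPrime ∧
        (∃ (v : HeightOneSpectrum (𝓞 ℚ)) (𝔓 : Ideal (absIntegers (𝓞 ℚ) ℚ)) (h : absoluteGaloisGroup ℚ),
          (ℓ : 𝓞 ℚ) ∈ v.asIdeal ∧ 𝔓 ∈ v.primesAbove ∧ IsArithFrobAt (𝓞 ℚ) h 𝔓 ∧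
          (∀ P : geomTorsion W ((2 ^ (n + 1) : ℕ) : ℤ), h • P = (c₀ * absGaloisRestrict ℚ K ρ) • P) ∧
          ∀ (e : K →ₐ[ℚ] AlgebraicClosure ℚ) (x : K), h • e x = c₀ • e x) ∧
        2 ^ (n + 1) ∣ ℓ + 1 ∧ ((2 : ℤ) ^ (n + 1)) ∣ W.frobeniusTrace ℓ ∧
        ∀ i, ∀ v : HeightOneSpectrum (𝓞 K), (ℓ : 𝓞 K) ∈ v.asIdeal →
          (((2 : ℤ) ^ Nv i) • cs i ∈
              (W.baseChange K).torsionLocalKer (v.adicCompletion K) ((2 ^ (n + 1) : ℕ) : ℤ) ∧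
            (Nv i ≠ 0 → ((2 : ℤ) ^ (Nv i - 1)) • cs i ∉
              (W.baseChange K).torsionLocalKer (v.adicCompletion K) ((2 ^ (n + 1) : ℕ) : ℤ))) := by
  obtain ⟨hS, hC⟩ := imageTokens_two_of_heegner (W := W) hK hodd hH hρ2
  exact exists_regular_kolyvaginPrime_of_supply_uniform hCheb hK n hc₀ (fun A ↦
    exists_mul_absGaloisRestrict_smul_eq_addAut_of_heegner hK hodd hH hsurj c₀ A) hc hS hC cs hπ hcs e he hind hres Nv hNe heM hNπ


end EnginePortKUniform

/-! ## §M′  The uniform supply in the STUB VOCABULARY (`Zhang2014.IsKolyvaginPrime N W K 2 ℓ`, `M(ℓ) ≥ n + 1`) and the primes-only supply -/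

section StubVocabularyMUniform

open WeierstrassCurve NumberField IsDedekindDomain Field
open Literature.NumberTheory.GaloisRepresentations Literature.NumberTheory.EllipticCurves Literature.NumberTheory
open Summit.BirchSwinnertonDyer.BirchSwinnertonDyer.Theorems

universe u

variable {W : WeierstrassCurve ℚ} {K : Type u} [Field K] [NumberField K]

/-- **THE ENGINE PORT IN THE BIG-IMAGE STUBS' OWN WORDS** (S3/S4/S5: `Zhang2014.IsKolyvaginPrime (W.conductorNorm ℤ) W K 2 ℓ`,
`levelIndex`): under the stub binders (`IsImaginaryQuadratic K`, `Odd d_K`, `SatisfiesHeegnerHypothesis N_E K`, `ρ̄_{E,2}` and `ρ̄_{E,2^{n+1}}` onto), a complex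
conjugation `c₀`, `c ≠ 1`, τ-stable class data and Čebotarev: ONE `ρ ∈ Γ_K` with `h = c₀ · res ρ` a lossless `μ`-inverting involution on `E[2^{n+1}]`, and beyond every
bound a prime `ℓ` which is a ZHANG–KOLYVAGIN PRIME AT `2` of level index `≥ n + 1`, whose Frobenius is `h` on `E[2^{n+1}]` and `c₀` on `K`, with the prescribed EXACT
local orders of the classes at `λ ∣ ℓ`.  (Take `N := W.conductorNorm ℤ`.) [cite: WZhang2014, Notations (xii)] [cite: GrossLMS1991, §3, §9] -/
theorem exists_regular_zhangKolyvaginPrimes_of_heegner_uniform (hCheb : Automorphic.chebotarev_artinRep) {N : ℕ}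
    [NeZero N] [W.IsElliptic] [W.IsGloballyMinimal] (hK : IsImaginaryQuadratic K)
    (hodd : Odd (NumberField.discr K)) (hH : SatisfiesHeegnerHypothesis (W.conductorNorm ℤ) K) (n : ℕ)
    (hρ2 : W.HasSurjectiveModNGaloisRep 2) (hsurj : W.HasSurjectiveModNGaloisRep ((2 ^ (n + 1) : ℕ) : ℤ))
    {c₀ : absoluteGaloisGroup ℚ} (hc₀ : IsComplexConjugation (Rat.castHom ℝ) c₀)
    {c : K ≃ₐ[ℚ] K} (hc : c ≠ 1)
    {r : ℕ} (cs : Fin r → galH1Torsion (W.baseChange K) ((2 ^ (n + 1) : ℕ) : ℤ)) {π : Fin r → Fin r}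
    (hπ : ∀ i, π (π i) = i) (hcs : ∀ i, conjAct W c ((2 ^ (n + 1) : ℕ) : ℤ) (cs i) = cs (π i))
    (e : Fin r → ℕ) (he : ∀ i, ((2 : ℤ) ^ e i) • cs i = 0)
    (hind : ∀ a : Fin r → ℤ, ∑ i, a i • cs i = 0 → ∀ i, ((2 : ℤ) ^ e i) ∣ a i)
    (hres : ∀ a : Fin r → ℤ, (∀ ρ ∈ torsionFixing (W.baseChange K) ((2 ^ (n + 1) : ℕ) : ℤ),
      h1Eval (W.baseChange K) ((2 ^ (n + 1) : ℕ) : ℤ) (∑ i, a i • cs i) ρ = 0) → ∑ i, a i • cs i = 0)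
    (Nv : Fin r → ℕ) (hNe : ∀ i, Nv i ≤ e i) (heM : ∀ i, e i ≤ n + 1) (hNπ : ∀ i, Nv (π i) = Nv i) :
    ∃ ρ : absoluteGaloisGroup K,
      (∀ X : geomTorsion W ((2 ^ (n + 1) : ℕ) : ℤ),
        (c₀ * absGaloisRestrict ℚ K ρ) • (c₀ * absGaloisRestrict ℚ K ρ) • X = X) ∧
      (∀ ζ : AlgebraicClosure ℚ, ζ ^ (2 ^ (n + 1)) = 1 → (c₀ * absGaloisRestrict ℚ K ρ) • ζ = ζ⁻¹) ∧
      (∃ P : geomTorsion W ((2 ^ (n + 1) : ℕ) : ℤ),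
        (2 : ℤ) ^ n • (P + (c₀ * absGaloisRestrict ℚ K ρ) • P) ≠ 0) ∧
      (∀ (k : ℕ) (X : geomTorsion W ((2 ^ (n + 1) : ℕ) : ℤ)), (2 : ℤ) ^ k • X = 0 →
          (c₀ * absGaloisRestrict ℚ K ρ) • X = X →
          ∃ Y : geomTorsion W ((2 ^ (n + 1) : ℕ) : ℤ),
            (2 : ℤ) ^ k • Y = 0 ∧ X = Y + (c₀ * absGaloisRestrict ℚ K ρ) • Y) ∧
      ∀ b : ℕ, ∃ ℓ : ℕ, b < ℓ ∧ Zhang2014.IsKolyvaginPrime N W K 2 ℓ ∧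
        ((n + 1 : ℕ) : ℕ∞) ≤ Zhang2014.levelIndex W 2 ℓ ∧
        (∃ (v : HeightOneSpectrum (𝓞 ℚ)) (𝔓 : Ideal (absIntegers (𝓞 ℚ) ℚ)) (h : absoluteGaloisGroup ℚ),
          (ℓ : 𝓞 ℚ) ∈ v.asIdeal ∧ 𝔓 ∈ v.primesAbove ∧ IsArithFrobAt (𝓞 ℚ) h 𝔓 ∧
          (∀ P : geomTorsion W ((2 ^ (n + 1) : ℕ) : ℤ), h • P = (c₀ * absGaloisRestrict ℚ K ρ) • P) ∧
          ∀ (e : K →ₐ[ℚ] AlgebraicClosure ℚ) (x : K), h • e x = c₀ • e x) ∧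
        ∀ i, ∀ v : HeightOneSpectrum (𝓞 K), (ℓ : 𝓞 K) ∈ v.asIdeal →
          (((2 : ℤ) ^ Nv i) • cs i ∈
              (W.baseChange K).torsionLocalKer (v.adicCompletion K) ((2 ^ (n + 1) : ℕ) : ℤ) ∧
            (Nv i ≠ 0 → ((2 : ℤ) ^ (Nv i - 1)) • cs i ∉
              (W.baseChange K).torsionLocalKer (v.adicCompletion K) ((2 ^ (n + 1) : ℕ) : ℤ))) := by
  obtain ⟨ρ, h1, h2, h3, h4, hℓ⟩ := exists_regular_kolyvaginPrime_of_heegner_uniform (N := N) hCheb hK hodd hH n hρ2 hsurj hc₀ hc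
    cs hπ hcs e he hind hres Nv hNe heM hNπ
  refine ⟨ρ, h1, h2, h3, h4, fun b ↦ ?_⟩
  obtain ⟨ℓ, hb, hℓp, hℓN, hℓd, hℓ2, hℓP, hfrob, hℓ1, hℓa, hloc⟩ := hℓ b
  obtain ⟨hZ, -, hlev⟩ := zhang_isKolyvaginPrime_two_of_regular (W := W) (K := K) (N := N) hℓp hℓN hℓd hℓ2 hℓP hℓ1 hℓa
  exact ⟨ℓ, hb, hZ, hlev, hfrob, hloc⟩


/-- **SELF-CONTAINED SUPPLY OF REGULAR ZHANG–KOLYVAGIN PRIMES FOR THE BIG-IMAGE STUBS** (no classes: `r = 0`; the complex conjugations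
`c₀ ∈ Γ_ℚ` and `c ∈ Aut(K/ℚ)` are PRODUCED, not assumed).  Hypotheses = Čebotarev + the stub binders `IsImaginaryQuadratic K`, `Odd d_K`,
`SatisfiesHeegnerHypothesis N_E K`, `ρ̄_{E,2}` onto, `ρ̄_{E,2^{n+1}}` onto.  Conclusion: a complex conjugation `c₀`, one `ρ ∈ Γ_K` with `h = c₀ · res ρ`
a LOSSLESS `μ_{2^{n+1}}`-inverting involution on `E[2^{n+1}]`, and beyond every bound a prime `ℓ` with `Zhang2014.IsKolyvaginPrime N W K 2 ℓ`,
`M(ℓ) ≥ n + 1`, whose arithmetic Frobenius is `h` on `E[2^{n+1}]` and `c₀` on `K`.  (S3's `n`-supply at any level; take `N := W.conductorNorm ℤ`.)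
[cite: WZhang2014, Notations (xii)] [cite: GrossLMS1991, §3, §9] -/
theorem exists_regular_zhangKolyvaginPrimes_of_heegner_primesOnly (hCheb : Automorphic.chebotarev_artinRep) {N : ℕ}
    [NeZero N] [W.IsElliptic] [W.IsGloballyMinimal] (hK : IsImaginaryQuadratic K)
    (hodd : Odd (NumberField.discr K)) (hH : SatisfiesHeegnerHypothesis (W.conductorNorm ℤ) K) (n : ℕ)
    (hρ2 : W.HasSurjectiveModNGaloisRep 2) (hsurj : W.HasSurjectiveModNGaloisRep ((2 ^ (n + 1) : ℕ) : ℤ)) :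
    ∃ (c₀ : absoluteGaloisGroup ℚ) (ρ : absoluteGaloisGroup K), IsComplexConjugation (Rat.castHom ℝ) c₀ ∧
      (∀ X : geomTorsion W ((2 ^ (n + 1) : ℕ) : ℤ),
        (c₀ * absGaloisRestrict ℚ K ρ) • (c₀ * absGaloisRestrict ℚ K ρ) • X = X) ∧
      (∀ ζ : AlgebraicClosure ℚ, ζ ^ (2 ^ (n + 1)) = 1 → (c₀ * absGaloisRestrict ℚ K ρ) • ζ = ζ⁻¹) ∧
      (∃ P : geomTorsion W ((2 ^ (n + 1) : ℕ) : ℤ),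
        (2 : ℤ) ^ n • (P + (c₀ * absGaloisRestrict ℚ K ρ) • P) ≠ 0) ∧
      (∀ (k : ℕ) (X : geomTorsion W ((2 ^ (n + 1) : ℕ) : ℤ)), (2 : ℤ) ^ k • X = 0 →
          (c₀ * absGaloisRestrict ℚ K ρ) • X = X →
          ∃ Y : geomTorsion W ((2 ^ (n + 1) : ℕ) : ℤ),
            (2 : ℤ) ^ k • Y = 0 ∧ X = Y + (c₀ * absGaloisRestrict ℚ K ρ) • Y) ∧
      ∀ b : ℕ, ∃ ℓ : ℕ, b < ℓ ∧ Zhang2014.IsKolyvaginPrime N W K 2 ℓ ∧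
        ((n + 1 : ℕ) : ℕ∞) ≤ Zhang2014.levelIndex W 2 ℓ ∧
        (∃ (v : HeightOneSpectrum (𝓞 ℚ)) (𝔓 : Ideal (absIntegers (𝓞 ℚ) ℚ)) (h : absoluteGaloisGroup ℚ),
          (ℓ : 𝓞 ℚ) ∈ v.asIdeal ∧ 𝔓 ∈ v.primesAbove ∧ IsArithFrobAt (𝓞 ℚ) h 𝔓 ∧
          (∀ P : geomTorsion W ((2 ^ (n + 1) : ℕ) : ℤ), h • P = (c₀ * absGaloisRestrict ℚ K ρ) • P) ∧
          ∀ (e : K →ₐ[ℚ] AlgebraicClosure ℚ) (x : K), h • e x = c₀ • e x) := by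
  obtain ⟨c₀, hc₀⟩ := exists_isComplexConjugation (Rat.castHom ℝ)
  -- a nontrivial `ℚ`-automorphism of `K` (`#Aut(K/ℚ) = [K:ℚ] = 2`; cf. `MuZeroCMKatzFrame.exists_algEquiv_ne_one_of_isImaginaryQuadratic`)
  obtain ⟨c, hc⟩ : ∃ c : K ≃ₐ[ℚ] K, c ≠ 1 := by
    haveI : Algebra.IsQuadraticExtension ℚ K := ⟨hK.1⟩
    have hcard : Nat.card (K ≃ₐ[ℚ] K) = 2 := by rw [IsGalois.card_aut_eq_finrank, hK.1]
    obtain ⟨y, hy, -⟩ := (Nat.card_eq_two_iff' (1 : K ≃ₐ[ℚ] K)).mp hcard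
    exact ⟨y, hy⟩
  obtain ⟨ρ, h1, h2, h3, h4, hℓ⟩ := exists_regular_zhangKolyvaginPrimes_of_heegner_uniform (N := N) hCheb hK hodd hH n
    hρ2 hsurj hc₀ hc (r := 0) (fun i ↦ i.elim0) (π := fun i ↦ i) (fun i ↦ rfl) (fun i ↦ i.elim0)
    (fun i ↦ i.elim0) (fun i ↦ i.elim0) (fun _ _ i ↦ i.elim0) (fun a _ ↦ by simp) (fun i ↦ i.elim0)
    (fun i ↦ i.elim0) (fun i ↦ i.elim0) (fun i ↦ i.elim0)
  refine ⟨c₀, ρ, hc₀, h1, h2, h3, h4, fun b ↦ ?_⟩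
  obtain ⟨ℓ, hb, hZ, hlev, hfrob, -⟩ := hℓ b
  exact ⟨ℓ, hb, hZ, hlev, hfrob⟩


end StubVocabularyMUniform

end Summit.BirchSwinnertonDyer.BirchSwinnertonDyer.Theorems.OffBigImageOddLocalAtTwo.Engine

end
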